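import Mathlib.Data.Real.Basic
import Mathlib.Tactic.Linarith
import Mathlib.Tactic.Positivity
import Mathlib.Tactic.Ring
import Summits.CriticalPhenomena.PercolationContinuityZ3.Theorems.PercNearOneGluingNoHeavyLowerTailAPLUnionClosure
import HarnessLib

/-!
# `NoHeavyLowerTail` (stmt-CriticalPhenomena-4575) — the Gladkov–Zimin (5.1) cone ALONE is a semigroup under the apex piece-union

Support file (prover prim-ineq-gen-8 gen 37; `--supports stmt-CriticalPhenomena-4575`; answers the question left open in
run/shared/lean/prim/prim-ineq-gen-8/FINDING-gen36-LEMMA-U.md §3(2)/§7; memo FINDING-gen37-PROFILE-FOREST.md §2).  Pure real algebra: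
no definitions, no named facts, no sorries.

SETTING as in `…APLUnionClosure.lean`: cells `u = (u0,uab,uac,ubc,u3) ≥ 0`, `v ≥ 0` of two instances `(a; b, c)` glued only at
`{a,b,c}`, union `w0 = u0v0`, `wab = u0vab + uab·v0 + uab·vab`, `wac`, `wbc` likewise, `w3` the rest; `S` = total mass,
GZ (5.1) `GZ(u) = (e+ubc)S − uab² − uac² − (u0+ubc)T ≥ 0` (`e = uab+uac`, `T = e+u3`).  Gen 36 proved `GZ(w) ≥ 0` only GIVEN `F_b, F_c` of both
pieces (an 80-term certificate) and reported that no Handelman certificate from `{GZ}` alone exists through bidegree (3,3), although no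
numerical violation was ever found.  The reason is that the certificate is PIECEWISE; here it is, in closed form.
With `A = u0 + ubc` (= `P(a ∤ bc)`), `c(u) := uab² + uac² + (u0 − e)S` one has `GZ(u) = A² − c(u)` and the union identity
  `GZ(w) = A_u²A_v² + B`,  `B := S_uS_v(wab + wac − u0v0) − wab² − wac²`,
and the two polynomials `N := c(u)c(v) + B` (71 monomials) and `M := c(u)·v0·S_v + B` have NONNEGATIVE coefficients.  Hence
  (i)  `A_v² ≥ v0S_v`:            `GZ(w) = v0S_v·GZ(u) + A_u²(A_v² − v0S_v) + M ≥ 0`;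
  (ii) `A_v² ≤ v0S_v`, `c(u) ≥ 0`: `GZ(w) = A_v²·GZ(u) + c(u)·GZ(v) + N ≥ 0`;
  (iii) `A_v² ≤ v0S_v`, `c(u) ≤ 0`: `GZ(w) = A_v²·GZ(u) + c(u)(A_v² − v0S_v) + M ≥ 0`,
i.e. `GZ(w) ≥ min(A_v², v0S_v)·GZ(u)` for every `u ≥ 0` and every `v ≥ 0` with `GZ(v) ≥ 0` (an S-lemma multiplier `min(A_v², v0S_v)`).
* `gz_union_alone` — **`u, v ≥ 0`, `GZ(u) ≥ 0`, `GZ(v) ≥ 0` ⟹ `GZ(u ∪ v) ≥ 0`** (same conclusion as `gz_union`, without `F_b, F_c`).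
* `region_union_GHA` — hence `{GZ, Harris, APL-G}` is already closed under the apex piece-union (`harris_union`, `aplg_union`).
Equality holds along the two-parameter family of GZ-tight "switch" pieces `(u0,0,0,ubc,u3)` with `ubc(u0+ubc) = u0u3`, and for pairs of
single `a–c` (or `a–b`) edges in `N`.  [this work]
-/

namespace Summit.CriticalPhenomena.PercolationContinuityZ3.Theorems

namespace APL

set_option maxHeartbeats 4000000 in
/-- **GZ (5.1) alone is preserved by the apex piece-union.**  For `u, v ≥ 0` with `GZ(u) ≥ 0`, `GZ(v) ≥ 0` the union `w = u ∪ v`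
satisfies `GZ(w) ≥ 0`.  Piecewise certificate: cases `A_v² ≷ v0·S_v` and `c(u) ≷ 0` (see the module docstring). [this work] -/
theorem gz_union_alone (u0 uab uac ubc u3 v0 vab vac vbc v3 : ℝ)
    (hu0 : 0 ≤ u0) (huab : 0 ≤ uab) (huac : 0 ≤ uac) (hubc : 0 ≤ ubc) (hu3 : 0 ≤ u3)
    (hv0 : 0 ≤ v0) (hvab : 0 ≤ vab) (hvac : 0 ≤ vac) (hvbc : 0 ≤ vbc) (hv3 : 0 ≤ v3)
    (hGZu : 0 ≤ (uab+uac+ubc)*(u0+uab+uac+ubc+u3) - uab^2 - uac^2 - (u0+ubc)*(uab+uac+u3))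
    (hGZv : 0 ≤ (vab+vac+vbc)*(v0+vab+vac+vbc+v3) - vab^2 - vac^2 - (v0+vbc)*(vab+vac+v3)) :
    0 ≤ ((u0*vab+uab*v0+uab*vab)+(u0*vac+uac*v0+uac*vac)+(u0*vbc+ubc*v0+ubc*vbc))*(u0*v0+(u0*vab+uab*v0+uab*vab)+(u0*vac+uac*v0+uac*vac)+(u0*vbc+ubc*v0+ubc*vbc)+(u3*(v0+vab+vac+vbc+v3)+(u0+uab+uac+ubc+u3)*v3-u3*v3+uab*(vac+vbc)+uac*(vab+vbc)+ubc*(vab+vac))) - (u0*vab+uab*v0+uab*vab)^2 - (u0*vac+uac*v0+uac*vac)^2 - (u0*v0+(u0*vbc+ubc*v0+ubc*vbc))*((u0*vab+uab*v0+uab*vab)+(u0*vac+uac*v0+uac*vac)+(u3*(v0+vab+vac+vbc+v3)+(u0+uab+uac+ubc+u3)*v3-u3*v3+uab*(vac+vbc)+uac*(vab+vbc)+ubc*(vab+vac))) := by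
  have hSv : 0 ≤ (v0+vab+vac+vbc+v3) := by positivity
  have hN : 0 ≤ u0*u3*vab^2 + u0*u3*vac^2 + u0*uab*v0*vac + 2*u0*uab*v3*vab + u0*uab*v3*vac + 3*u0*uab*vab*vac + 2*u0*uab*vab*vbc + u0*uab*vac*vbc + u0*uab*vac^2 + u0*uac*v0*vab + u0*uac*v3*vab + 2*u0*uac*v3*vac + 3*u0*uac*vab*vac + u0*uac*vab*vbc + u0*uac*vab^2 + 2*u0*uac*vac*vbc + u0*ubc*vab^2 + u0*ubc*vac^2 + 2*u3*uab*v0*vab + u3*uab*v0*vac + 2*u3*uab*v3*vab + u3*uab*v3*vac + 3*u3*uab*vab*vac + 2*u3*uab*vab*vbc + u3*uab*vab^2 + u3*uab*vac*vbc + u3*uac*v0*vab + 2*u3*uac*v0*vac + u3*uac*v3*vab + 2*u3*uac*v3*vac + 3*u3*uac*vab*vac + u3*uac*vab*vbc + 2*u3*uac*vac*vbc + u3*uac*vac^2 + 3*uab*uac*v0*vab + 3*uab*uac*v0*vac + 3*uab*uac*v3*vab + 3*uab*uac*v3*vac + 6*uab*uac*vab*vac + 3*uab*uac*vab*vbc +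 uab*uac*vab^2 + 3*uab*uac*vac*vbc + uab*uac*vac^2 + 2*uab*ubc*v0*vab + uab*ubc*v0*vac + 2*uab*ubc*v3*vab + uab*ubc*v3*vac + 3*uab*ubc*vab*vac + 2*uab*ubc*vab*vbc + uab*ubc*vab^2 + uab*ubc*vac*vbc + uab^2*v0*v3 + uab^2*v0*vac + uab^2*v0*vbc + uab^2*v3*vab + uab^2*vab*vac + uab^2*vab*vbc + uac*ubc*v0*vab + 2*uac*ubc*v0*vac + uac*ubc*v3*vab + 2*uac*ubc*v3*vac + 3*uac*ubc*vab*vac + uac*ubc*vab*vbc + 2*uac*ubc*vac*vbc + uac*ubc*vac^2 + uac^2*v0*v3 + uac^2*v0*vab + uac^2*v0*vbc + uac^2*v3*vac + uac^2*vab*vac + uac^2*vac*vbc := by positivity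
  have hM : 0 ≤ (uab^2*v0*(vac+vbc+v3) + u0^2*v0*vab + (u0+uab)*vab*((u0+uab)*(vac+vbc+v3) + (uac+ubc+u3)*(v0+vab+vac+vbc+v3)) + uac^2*v0*(vab+vbc+v3) + u0^2*v0*vac + (u0+uac)*vac*((u0+uac)*(vab+vbc+v3) + (uab+ubc+u3)*(v0+vab+vac+vbc+v3))) := by positivity
  by_cases hA : v0*(v0+vab+vac+vbc+v3) ≤ (v0+vbc)^2
  · have I4 : ((u0*vab+uab*v0+uab*vab)+(u0*vac+uac*v0+uac*vac)+(u0*vbc+ubc*v0+ubc*vbc))*(u0*v0+(u0*vab+uab*v0+uab*vab)+(u0*vac+uac*v0+uac*vac)+(u0*vbc+ubc*v0+ubc*vbc)+(u3*(v0+vab+vac+vbc+v3)+(u0+uab+uac+ubc+u3)*v3-u3*v3+uab*(vac+vbc)+uac*(vab+vbc)+ubc*(vab+vac))) - (u0*vab+uab*v0+uab*vab)^2 - (u0*vac+uac*v0+uac*vac)^2 - (u0*v0+(u0*vbc+ubc*v0+ubc*vbc))*((u0*vab+uab*v0+uab*vab)+(u0*vac+uac*v0+uac*vac)+(u3*(v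0+vab+vac+vbc+v3)+(u0+uab+uac+ubc+u3)*v3-u3*v3+uab*(vac+vbc)+uac*(vab+vbc)+ubc*(vab+vac)))
        = v0*(v0+vab+vac+vbc+v3)*((uab+uac+ubc)*(u0+uab+uac+ubc+u3) - uab^2 - uac^2 - (u0+ubc)*(uab+uac+u3)) + (u0+ubc)^2*((v0+vbc)^2 - v0*(v0+vab+vac+vbc+v3))
          + (uab^2*v0*(vac+vbc+v3) + u0^2*v0*vab + (u0+uab)*vab*((u0+uab)*(vac+vbc+v3) + (uac+ubc+u3)*(v0+vab+vac+vbc+v3)) + uac^2*v0*(vab+vbc+v3) + u0^2*v0*vac + (u0+uac)*vac*((u0+uac)*(vab+vbc+v3) + (uab+ubc+u3)*(v0+vab+vac+vbc+v3))) := by ring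
    have h1 : 0 ≤ v0*(v0+vab+vac+vbc+v3)*((uab+uac+ubc)*(u0+uab+uac+ubc+u3) - uab^2 - uac^2 - (u0+ubc)*(uab+uac+u3)) := mul_nonneg (mul_nonneg hv0 hSv) hGZu
    have h2 : 0 ≤ (u0+ubc)^2*((v0+vbc)^2 - v0*(v0+vab+vac+vbc+v3)) := mul_nonneg (sq_nonneg _) (sub_nonneg.2 hA)
    rw [I4]
    exact add_nonneg (add_nonneg h1 h2) hM
  · have hA' : (v0+vbc)^2 - v0*(v0+vab+vac+vbc+v3) ≤ 0 := by linarith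
    by_cases hc : 0 ≤ (uab^2+uac^2+(u0-(uab+uac))*(u0+uab+uac+ubc+u3))
    · have I2 : ((u0*vab+uab*v0+uab*vab)+(u0*vac+uac*v0+uac*vac)+(u0*vbc+ubc*v0+ubc*vbc))*(u0*v0+(u0*vab+uab*v0+uab*vab)+(u0*vac+uac*v0+uac*vac)+(u0*vbc+ubc*v0+ubc*vbc)+(u3*(v0+vab+vac+vbc+v3)+(u0+uab+uac+ubc+u3)*v3-u3*v3+uab*(vac+vbc)+uac*(vab+vbc)+ubc*(vab+vac))) - (u0*vab+uab*v0+uab*vab)^2 - (u0*vac+uac*v0+uac*vac)^2 - (u0*v0+(u0*vbc+ubc*v0+ubc*vbc))*((u0*vab+uab*v0+uab*vab)+(u0*vac+uac*v0+uac*vac)+(u3*(v0+vab+vac+vbc+v3)+(u0+uab+uac+ubc+u3)*v3-u3*v3+uab*(vac+vbc)+uac*(vab+vbc)+ubc*(vab+vac)))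
          = (v0+vbc)^2*((uab+uac+ubc)*(u0+uab+uac+ubc+u3) - uab^2 - uac^2 - (u0+ubc)*(uab+uac+u3)) + (uab^2+uac^2+(u0-(uab+uac))*(u0+uab+uac+ubc+u3))*((vab+vac+vbc)*(v0+vab+vac+vbc+v3) - vab^2 - vac^2 - (v0+vbc)*(vab+vac+v3))
            + (u0*u3*vab^2 + u0*u3*vac^2 + u0*uab*v0*vac + 2*u0*uab*v3*vab + u0*uab*v3*vac + 3*u0*uab*vab*vac + 2*u0*uab*vab*vbc + u0*uab*vac*vbc + u0*uab*vac^2 + u0*uac*v0*vab + u0*uac*v3*vab + 2*u0*uac*v3*vac + 3*u0*uac*vab*vac + u0*uac*vab*vbc + u0*uac*vab^2 + 2*u0*uac*vac*vbc + u0*ubc*vab^2 + u0*ubc*vac^2 + 2*u3*uab*v0*vab + u3*uab*v0*vac + 2*u3*uab*v3*vab + u3*uab*v3*vac + 3*u3*uab*vab*vac + 2*u3*uab*vab*vbc + u3*uab*vab^2 + u3*uab*vac*vbc + u3*uac*v0*vab + 2*u3*uac*v0*vac + u3*uac*v3*vab + 2*u3*uac*v3*vac + 3*u3*uac*vab*vac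 + u3*uac*vab*vbc + 2*u3*uac*vac*vbc + u3*uac*vac^2 + 3*uab*uac*v0*vab + 3*uab*uac*v0*vac + 3*uab*uac*v3*vab + 3*uab*uac*v3*vac + 6*uab*uac*vab*vac + 3*uab*uac*vab*vbc + uab*uac*vab^2 + 3*uab*uac*vac*vbc + uab*uac*vac^2 + 2*uab*ubc*v0*vab + uab*ubc*v0*vac + 2*uab*ubc*v3*vab + uab*ubc*v3*vac + 3*uab*ubc*vab*vac + 2*uab*ubc*vab*vbc + uab*ubc*vab^2 + uab*ubc*vac*vbc + uab^2*v0*v3 + uab^2*v0*vac + uab^2*v0*vbc + uab^2*v3*vab + uab^2*vab*vac + uab^2*vab*vbc + uac*ubc*v0*vab + 2*uac*ubc*v0*vac + uac*ubc*v3*vab + 2*uac*ubc*v3*vac + 3*uac*ubc*vab*vac + uac*ubc*vab*vbc + 2*uac*ubc*vac*vbc + uac*ubc*vac^2 + uac^2*v0*v3 + uac^2*v0*vab + uac^2*v0*vbc + uac^2*v3*vac + uac^2*vab*vac + uac^2*vac*vbc) := by ring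
      have h1 : 0 ≤ (v0+vbc)^2*((uab+uac+ubc)*(u0+uab+uac+ubc+u3) - uab^2 - uac^2 - (u0+ubc)*(uab+uac+u3)) := mul_nonneg (sq_nonneg _) hGZu
      have h2 : 0 ≤ (uab^2+uac^2+(u0-(uab+uac))*(u0+uab+uac+ubc+u3))*((vab+vac+vbc)*(v0+vab+vac+vbc+v3) - vab^2 - vac^2 - (v0+vbc)*(vab+vac+v3)) := mul_nonneg hc hGZv
      rw [I2]
      exact add_nonneg (add_nonneg h1 h2) hN
    · have I3 : ((u0*vab+uab*v0+uab*vab)+(u0*vac+uac*v0+uac*vac)+(u0*vbc+ubc*v0+ubc*vbc))*(u0*v0+(u0*vab+uab*v0+uab*vab)+(u0*vac+uac*v0+uac*vac)+(u0*vbc+ubc*v0+ubc*vbc)+(u3*(v0+vab+vac+vbc+v3)+(u0+uab+uac+ubc+u3)*v3-u3*v3+uab*(vac+vbc)+uac*(vab+vbc)+ubc*(vab+vac))) - (u0*vab+uab*v0+uab*vab)^2 - (u0*vac+uac*v0+uac*vac)^2 - (u0*v0+(u0*vbc+ubc*v0+ubc*vbc))*((u0*vab+uab*v0+uab*vab)+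(u0*vac+uac*v0+uac*vac)+(u3*(v0+vab+vac+vbc+v3)+(u0+uab+uac+ubc+u3)*v3-u3*v3+uab*(vac+vbc)+uac*(vab+vbc)+ubc*(vab+vac)))
          = (v0+vbc)^2*((uab+uac+ubc)*(u0+uab+uac+ubc+u3) - uab^2 - uac^2 - (u0+ubc)*(uab+uac+u3)) + (uab^2+uac^2+(u0-(uab+uac))*(u0+uab+uac+ubc+u3))*((v0+vbc)^2 - v0*(v0+vab+vac+vbc+v3))
            + (uab^2*v0*(vac+vbc+v3) + u0^2*v0*vab + (u0+uab)*vab*((u0+uab)*(vac+vbc+v3) + (uac+ubc+u3)*(v0+vab+vac+vbc+v3)) + uac^2*v0*(vab+vbc+v3) + u0^2*v0*vac + (u0+uac)*vac*((u0+uac)*(vab+vbc+v3) + (uab+ubc+u3)*(v0+vab+vac+vbc+v3))) := by ring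
      have h1 : 0 ≤ (v0+vbc)^2*((uab+uac+ubc)*(u0+uab+uac+ubc+u3) - uab^2 - uac^2 - (u0+ubc)*(uab+uac+u3)) := mul_nonneg (sq_nonneg _) hGZu
      have h2 : 0 ≤ (uab^2+uac^2+(u0-(uab+uac))*(u0+uab+uac+ubc+u3))*((v0+vbc)^2 - v0*(v0+vab+vac+vbc+v3)) := mul_nonneg_of_nonpos_of_nonpos (le_of_lt (lt_of_not_ge hc)) hA'
      rw [I3]
      exact add_nonneg (add_nonneg h1 h2) hM

/-- **`{GZ, Harris, APL-G}` is a semigroup under the apex piece-union** (no `F_b, F_c` needed; `gz_union_alone`, `harris_union`,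
`aplg_union`). [this work] -/
theorem region_union_GHA (u0 uab uac ubc u3 v0 vab vac vbc v3 : ℝ)
    (hu0 : 0 ≤ u0) (huab : 0 ≤ uab) (huac : 0 ≤ uac) (hubc : 0 ≤ ubc) (hu3 : 0 ≤ u3)
    (hv0 : 0 ≤ v0) (hvab : 0 ≤ vab) (hvac : 0 ≤ vac) (hvbc : 0 ≤ vbc) (hv3 : 0 ≤ v3)
    (hGZu : 0 ≤ (uab+uac+ubc)*(u0+uab+uac+ubc+u3) - uab^2 - uac^2 - (u0+ubc)*(uab+uac+u3))
    (hHu : (uab+uac)*(u0+uab+uac+ubc+u3) ≤ (uab+uac+u3)*(u0+uab+uac))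
    (hGu : ((uab+uac+u3)*(u0+uab+uac) - (uab+uac)*(u0+uab+uac+ubc+u3))^2 ≤ uab*uac*(u0+uab+uac+ubc+u3)^2)
    (hGZv : 0 ≤ (vab+vac+vbc)*(v0+vab+vac+vbc+v3) - vab^2 - vac^2 - (v0+vbc)*(vab+vac+v3))
    (hHv : (vab+vac)*(v0+vab+vac+vbc+v3) ≤ (vab+vac+v3)*(v0+vab+vac))
    (hGv : ((vab+vac+v3)*(v0+vab+vac) - (vab+vac)*(v0+vab+vac+vbc+v3))^2 ≤ vab*vac*(v0+vab+vac+vbc+v3)^2) :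
    0 ≤ ((u0*vab+uab*v0+uab*vab)+(u0*vac+uac*v0+uac*vac)+(u0*vbc+ubc*v0+ubc*vbc))*(u0*v0+(u0*vab+uab*v0+uab*vab)+(u0*vac+uac*v0+uac*vac)+(u0*vbc+ubc*v0+ubc*vbc)+(u3*(v0+vab+vac+vbc+v3)+(u0+uab+uac+ubc+u3)*v3-u3*v3+uab*(vac+vbc)+uac*(vab+vbc)+ubc*(vab+vac))) - (u0*vab+uab*v0+uab*vab)^2 - (u0*vac+uac*v0+uac*vac)^2 - (u0*v0+(u0*vbc+ubc*v0+ubc*vbc))*((u0*vab+uab*v0+uab*vab)+(u0*vac+uac*v0+uac*vac)+(u3*(v0+vab+vac+vbc+v3)+(u0+uab+uac+ubc+u3)*v3-u3*v3+uab*(vac+vbc)+uac*(vab+vbc)+ubc*(vab+vac)))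
    ∧ ((u0*vab+uab*v0+uab*vab)+(u0*vac+uac*v0+uac*vac))*(u0*v0+(u0*vab+uab*v0+uab*vab)+(u0*vac+uac*v0+uac*vac)+(u0*vbc+ubc*v0+ubc*vbc)+(u3*(v0+vab+vac+vbc+v3)+(u0+uab+uac+ubc+u3)*v3-u3*v3+uab*(vac+vbc)+uac*(vab+vbc)+ubc*(vab+vac)))
      ≤ ((u0*vab+uab*v0+uab*vab)+(u0*vac+uac*v0+uac*vac)+(u3*(v0+vab+vac+vbc+v3)+(u0+uab+uac+ubc+u3)*v3-u3*v3+uab*(vac+vbc)+uac*(vab+vbc)+ubc*(vab+vac)))*(u0*v0+(u0*vab+uab*v0+uab*vab)+(u0*vac+uac*v0+uac*vac))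
    ∧ (((u0*vab+uab*v0+uab*vab)+(u0*vac+uac*v0+uac*vac)+(u3*(v0+vab+vac+vbc+v3)+(u0+uab+uac+ubc+u3)*v3-u3*v3+uab*(vac+vbc)+uac*(vab+vbc)+ubc*(vab+vac)))*(u0*v0+(u0*vab+uab*v0+uab*vab)+(u0*vac+uac*v0+uac*vac)) - ((u0*vab+uab*v0+uab*vab)+(u0*vac+uac*v0+uac*vac))*(u0*v0+(u0*vab+uab*v0+uab*vab)+(u0*vac+uac*v0+uac*vac)+(u0*vbc+ubc*v0+ubc*vbc)+(u3*(v0+vab+vac+vbc+v3)+(u0+uab+uac+ubc+u3)*v3-u3*v3+uab*(vac+vbc)+uac*(vab+vbc)+ubc*(vab+vac))))^2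
      ≤ (u0*vab+uab*v0+uab*vab)*(u0*vac+uac*v0+uac*vac)*(u0*v0+(u0*vab+uab*v0+uab*vab)+(u0*vac+uac*v0+uac*vac)+(u0*vbc+ubc*v0+ubc*vbc)+(u3*(v0+vab+vac+vbc+v3)+(u0+uab+uac+ubc+u3)*v3-u3*v3+uab*(vac+vbc)+uac*(vab+vbc)+ubc*(vab+vac)))^2 :=
  ⟨gz_union_alone u0 uab uac ubc u3 v0 vab vac vbc v3 hu0 huab huac hubc hu3 hv0 hvab hvac hvbc hv3 hGZu hGZv,
    harris_union u0 uab uac ubc u3 v0 vab vac vbc v3 hu0 huab huac hubc hv0 hvab hvac hvbc hv3 hHu hHv,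
    aplg_union u0 uab uac ubc u3 v0 vab vac vbc v3 hu0 huab huac hubc hu3 hv0 hvab hvac hvbc hv3 hHu hGu hHv hGv⟩

end APL

end Summit.CriticalPhenomena.PercolationContinuityZ3.Theorems
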